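import Summits.KontsevichZagierPeriods.KontsevichZagierPeriods.Theorems.HurwitzMicroSectorsNormalFormPrincipleQuadKit
import Summits.KontsevichZagierPeriods.KontsevichZagierPeriods.Theorems.AbelContractionRealHyperellipticSectorPortSlabASubPtK24

/-!
# Route AbelContraction — `RealHyperellipticSector` (crux stmt-KontsevichZagierPeriods-12475):
# the dimension-certified port, layer 2 — the reduction formulas for higher quadratic poles

Helper file of the line `Lines/birth.lean` (stub `stub_bakerAlg`, `--supports` the crux): the port
of `Theorems/HurwitzMicroSectorsNormalFormPrincipleQuadKit.lean` (namespace
`…NormalFormPrinciple.PiBox.Dlog`) INTO THE BUDGET `KZ.relationsLE 1`: the two reduction moves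
for higher quadratic poles `(A(x−u) + B)/((x−u)²+v²)ⁿ` (`v ≠ 0`, real algebraic data),

* `quad_highA_sub_pt_mem_relationsLE` — the odd part is a point (ONE Newton–Leibniz move `1 → 0`
  with algebraic ends, `Port.SlabA.slabA_sub_pt_mem_relationsLE`);
* `quad_highB_mem_relationsLE` (registered sub-goal) — the classical reduction formula for the
  even part (integrand additivity among representations of dimension `1`, rule 1b, plus ONE
  Newton–Leibniz move `1 → 0`),

each with the certificate that its representations have dimension `≤ 1`. The dimension-free
lemmas of the original (`exists_rep_of_continuousOn`, `quad_pos`, `isSemialgebraicFunOn_quad`,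
`continuous_quad`, `exists_quadRep`, `hasDerivAt_const_div_quadPow`,
`hasDerivAt_lin_div_quadPow`) are reused by importing it.

Sources: M. Kontsevich, D. Zagier, *Periods* (2001), §1.2 rules (1), (3) [KontsevichZagier2001].
No definitions are introduced.
-/

noncomputable section

open MeasureTheory Set
open Literature.NumberTheory.Transcendental Literature.NumberTheory.Transcendental.KZ
open Literature.ModelTheory.ExponentialFields (IsSemialgebraic)
open Summit.KontsevichZagierPeriods.AbelContraction.AbelContractionLemma
  (mem_relationsLE_of_integrandAdd)

namespace Summit.KontsevichZagierPeriods.AbelContraction.RealHyperellipticSector.Port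

namespace Dlog

open Summit.KontsevichZagierPeriods.HurwitzMicroSectors.NormalFormPrinciple.PiBox.Dlog
  (isSemialgebraic_setOf_apply_mem_Ioo_of_isAlgebraic exists_rep_of_continuousOn quad_pos
    isSemialgebraicFunOn_quad continuous_quad hasDerivAt_const_div_quadPow
    hasDerivAt_lin_div_quadPow)
open Summit.KontsevichZagierPeriods.HurwitzMicroSectors.NormalFormPrinciple.PiBox.SlabA
  (isSemialgebraic_setOf_apply_mem_Icc)

/-! ## Higher quadratic poles are Newton–Leibniz moves inside the budget -/

/-- **The odd part of a higher quadratic pole is a point** (inside the budget `relationsLE 1`):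
`[(a,b), −2(n+1)α(x−u)/((x−u)²+v²)^{n+2}]` is one Newton–Leibniz move `1 → 0` from
`[pt, F(b) − F(a)]`, `F = α/((x−u)²+v²)^{n+1}`. [cite: KontsevichZagier2001, §1.2 rule (3)] -/
theorem quad_highA_sub_pt_mem_relationsLE {a b α u v : ℝ} (ha : IsAlgebraic ℚ a)
    (hb : IsAlgebraic ℚ b) (hα : IsAlgebraic ℚ α) (hu : IsAlgebraic ℚ u) (hv : IsAlgebraic ℚ v)
    (hv0 : v ≠ 0) (hab : a ≤ b) (n : ℕ) (N : IntegralRep 1)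
    (hNd : N.domain = {x | x 0 ∈ Set.Ioo a b})
    (hNi : EqOn N.integrand
      (fun x => -(2 * ((n:ℝ) + 1) * α) * (x 0 - u) / ((x 0 - u) ^ 2 + v ^ 2) ^ (n + 2)) N.domain)
    (Z : IntegralRep 0) (hZd : Z.domain = univ)
    (hZi : Z.integrand = fun _ =>
      α / ((b - u) ^ 2 + v ^ 2) ^ (n + 1) - α / ((a - u) ^ 2 + v ^ 2) ^ (n + 1)) :
    of N - of Z ∈ relationsLE 1 := by
  have hIcc : IsSemialgebraic ℚ {x : Fin 1 → ℝ | x 0 ∈ Set.Icc a b} :=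
    isSemialgebraic_setOf_apply_mem_Icc ha hb
  have hcA : IsAlgebraic ℚ (-(2 * ((n:ℝ) + 1) * α)) :=
    (((isAlgebraic_nat (R := ℚ) 2).mul ((isAlgebraic_nat (R := ℚ) n).add isAlgebraic_one)).mul hα).neg
  refine SlabA.slabA_sub_pt_mem_relationsLE ha hb hab
    (fun t => -(2 * ((n:ℝ) + 1) * α) * (t - u) / ((t - u) ^ 2 + v ^ 2) ^ (n + 2))
    (fun t => α / ((t - u) ^ 2 + v ^ 2) ^ (n + 1)) ?_ ?_
    (fun t _ => hasDerivAt_const_div_quadPow α u v n t (quad_pos hv0 t).ne') ?_ N hNd hNi Z hZd hZi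
  · exact (isSemialgebraicFunOn_quad hIcc isAlgebraic_zero hα hu hv hv0 (n + 1)).congr
      fun x _ => by simp only [zero_mul, zero_add]
  · exact (continuous_const.div (by fun_prop) fun t =>
      pow_ne_zero _ (quad_pos hv0 t).ne').continuousOn
  · exact (isSemialgebraicFunOn_quad hIcc hcA isAlgebraic_zero hu hv hv0 (n + 2)).congr
      fun x _ => by simp only [add_zero]

/-- **The even part of a higher quadratic pole reduces** (the classical reduction formula, by rules
(1) and (3) among representations of dimension `≤ 1`) (inside the budget `relationsLE 1`;
registered sub-goal of crux stmt-KontsevichZagierPeriods-12475, port of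
`PiBox.Dlog.quad_highB_mem_relations`): with `G = α(x−u)/((x−u)²+v²)^{n+1}`,
`[(a,b), 2(n+1)v²α/((x−u)²+v²)^{n+2}] − [pt, G(b) − G(a)] − [(a,b), (2n+1)α/((x−u)²+v²)^{n+1}]
∈ relationsLE 1`. [cite: KontsevichZagier2001, §1.2 rules (1), (3)] -/
theorem quad_highB_mem_relationsLE : ∀ {a b α u v : ℝ}, IsAlgebraic ℚ a → IsAlgebraic ℚ b →
    IsAlgebraic ℚ α → IsAlgebraic ℚ u → IsAlgebraic ℚ v → v ≠ 0 → a ≤ b → ∀ (n : ℕ)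
    (N : KZ.IntegralRep 1), N.domain = {x | x 0 ∈ Set.Ioo a b} →
    Set.EqOn N.integrand
      (fun x => (2 * ((n:ℝ) + 1) * v ^ 2 * α) / ((x 0 - u) ^ 2 + v ^ 2) ^ (n + 2)) N.domain →
    ∀ (Z : KZ.IntegralRep 0), Z.domain = Set.univ →
    (Z.integrand = fun _ =>
      α * (b - u) / ((b - u) ^ 2 + v ^ 2) ^ (n + 1) - α * (a - u) / ((a - u) ^ 2 + v ^ 2) ^ (n + 1)) →
    ∀ (N' : KZ.IntegralRep 1), N'.domain = {x | x 0 ∈ Set.Ioo a b} →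
    Set.EqOn N'.integrand
      (fun x => ((2 * (n:ℝ) + 1) * α) / ((x 0 - u) ^ 2 + v ^ 2) ^ (n + 1)) N'.domain →
    KZ.of N - KZ.of Z - KZ.of N' ∈ KZ.relationsLE 1 := by
  intro a b α u v ha hb hα hu hv hv0 hab n N hNd hNi Z hZd hZi N' hN'd hN'i
  have hIcc : IsSemialgebraic ℚ {x : Fin 1 → ℝ | x 0 ∈ Set.Icc a b} :=
    isSemialgebraic_setOf_apply_mem_Icc ha hb
  have hIoo : IsSemialgebraic ℚ {x : Fin 1 → ℝ | x 0 ∈ Set.Ioo a b} :=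
    isSemialgebraic_setOf_apply_mem_Ioo_of_isAlgebraic ha hb 0
  have hn1 : IsAlgebraic ℚ ((n:ℝ) + 1) := (isAlgebraic_nat (R := ℚ) n).add isAlgebraic_one
  have hcA : IsAlgebraic ℚ (2 * ((n:ℝ) + 1) * v ^ 2 * α) :=
    (((isAlgebraic_nat (R := ℚ) 2).mul hn1).mul (hv.pow 2)).mul hα
  have hc'A : IsAlgebraic ℚ ((2 * (n:ℝ) + 1) * α) :=
    (((isAlgebraic_nat (R := ℚ) 2).mul (isAlgebraic_nat (R := ℚ) n)).add isAlgebraic_one).mul hα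
  -- the derivative `g = G'` as an integrand, and a representation for it
  set g : ℝ → ℝ := fun t => (2 * ((n:ℝ) + 1) * v ^ 2 * α) / ((t - u) ^ 2 + v ^ 2) ^ (n + 2) -
    ((2 * (n:ℝ) + 1) * α) / ((t - u) ^ 2 + v ^ 2) ^ (n + 1) with hg
  have hgsa : ∀ {s : Set (Fin 1 → ℝ)}, IsSemialgebraic ℚ s →
      IsSemialgebraicFunOn ℚ s (fun x => g (x 0)) := by
    intro s hs
    have h1 : IsSemialgebraicFunOn ℚ s
        (fun x => (2 * ((n:ℝ) + 1) * v ^ 2 * α) / ((x 0 - u) ^ 2 + v ^ 2) ^ (n + 2)) :=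
      (isSemialgebraicFunOn_quad hs isAlgebraic_zero hcA hu hv hv0 (n + 2)).congr
        fun x _ => by simp only [zero_mul, zero_add]
    have h2 : IsSemialgebraicFunOn ℚ s
        (fun x => ((2 * (n:ℝ) + 1) * α) / ((x 0 - u) ^ 2 + v ^ 2) ^ (n + 1)) :=
      (isSemialgebraicFunOn_quad hs isAlgebraic_zero hc'A hu hv hv0 (n + 1)).congr
        fun x _ => by simp only [zero_mul, zero_add]
    exact IsSemialgebraicFunOn.sub_holds h1 h2
  have hgc : Continuous g :=
    (continuous_const.div (by fun_prop) fun t => pow_ne_zero _ (quad_pos hv0 t).ne').sub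
      (continuous_const.div (by fun_prop) fun t => pow_ne_zero _ (quad_pos hv0 t).ne')
  obtain ⟨N₁, hN₁d, hN₁i⟩ := exists_rep_of_continuousOn ha hb g (hgsa hIoo) hgc.continuousOn
  -- additivity of the integrand, among representations of dimension `1`
  have hadd : of N - of N₁ - of N' ∈ relationsLE 1 := by
    refine mem_relationsLE_of_integrandAdd le_rfl (by rw [hN₁d, hNd]) (by rw [hN'd, hNd])
      fun x hx => ?_
    rw [Pi.add_apply, hNi hx, hN₁i, hN'i (by rw [hN'd, ← hNd]; exact hx), hg]
    simp only
    ring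
  -- Newton–Leibniz `1 → 0` for `g`
  have hNL : of N₁ - of Z ∈ relationsLE 1 := by
    refine SlabA.slabA_sub_pt_mem_relationsLE ha hb hab g
      (fun t => α * (t - u) / ((t - u) ^ 2 + v ^ 2) ^ (n + 1))
      ?_ ?_ (fun t _ => ?_) (hgsa hIcc) N₁ hN₁d (by rw [hN₁i]; exact fun _ _ => rfl) Z hZd hZi
    · exact (isSemialgebraicFunOn_quad hIcc hα isAlgebraic_zero hu hv hv0 (n + 1)).congr
        fun x _ => by simp only [add_zero]
    · exact ((continuous_quad (A := α) (B := 0) (u := u) hv0 (n + 1)).congr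
        fun t => by simp only [add_zero]).continuousOn
    · have hQ := (quad_pos (u := u) hv0 t).ne'
      refine (hasDerivAt_lin_div_quadPow α u v n t hQ).congr_deriv ?_
      rw [hg]
      simp only
      rw [div_sub_div _ _ (pow_ne_zero _ hQ) (pow_ne_zero _ hQ),
        div_eq_div_iff (pow_ne_zero _ hQ) (mul_ne_zero (pow_ne_zero _ hQ) (pow_ne_zero _ hQ))]
      ring
  have : of N - of Z - of N' = (of N - of N₁ - of N') + (of N₁ - of Z) := by abel
  rw [this]
  exact (relationsLE 1).add_mem hadd hNL

end Dlog

end Summit.KontsevichZagierPeriods.AbelContraction.RealHyperellipticSector.Port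

end
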